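import Mathlib
import HarnessLib
import Literature.NumberTheory.Transcendental.KZCalculus
import Literature.NumberTheory.Transcendental.KZGroundingRelations
import Literature.NumberTheory.Transcendental.KZSemiCanonicalReductionProofs
import Literature.NumberTheory.Transcendental.KZLogCalculusProofs
import Literature.NumberTheory.Transcendental.KZUnfolding
import Literature.NumberTheory.Transcendental.KZProductIdeal
import Literature.NumberTheory.Transcendental.KZDominatedFamilyRelations
import Literature.NumberTheory.Transcendental.KZSemialgebraicComplex
import Literature.NumberTheory.Transcendental.SemialgebraicMapsProofs

/-!
# `stub_integrateOut` (line `janus-bands`, crux `ArrangementNormalForm`), part 1: generic moves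

General-purpose lemmas on the Kontsevich–Zagier calculus of moves used to integrate out a base
coordinate (namespace `…JanusBands.IntegrateOut`):

* `of_sub_of_reindex_mem_relations` — relabelling coordinates along `Fin n ≃ Fin k` is a relation;
* `isSemialgebraicFunOn_div`, `isSemialgebraicFunOn_finset_prod`, `isSemialgebraicFunOn_pow` —
  closure properties of real semialgebraic functions (division with Lean's convention `x / 0 = 0`);
* `newtonLeibniz_pack` — the Newton–Leibniz move (rule 3) over an OPEN band, packaged: from a
  representation on `{(x, t) | x ∈ τ, a x < t < b x}`, a fibrewise primitive `F` and its
  derivative `f`, it produces the base representation `[τ, F (x, b x) − F (x, a x)]`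
  (integrability of the base integrand by Fubini and the fundamental theorem of calculus);
* `volume_eq_zero_of_lintegral_fibre_eq_top` — a measurable set on whose non-empty
  last-coordinate fibres an integrable function has infinite integral is null (Tonelli);
* `lintegral_enorm_div_pow_eq_top` — `K / (t − c)^n`, `K ≠ 0`, `n ≥ 1`, has infinite integral on
  an open interval whose closure contains `c`;
* `ev`, `affPoly` — rational affine data and their evaluation.

Registered sub-goal proved here: `integrateOut_newtonLeibniz`.
-/

noncomputable section

open Set MeasureTheory
open Literature.NumberTheory.Transcendental
open Literature.ModelTheory.ExponentialFields

namespace Summit.KontsevichZagierPeriods.ArrangementNormalForm.JanusBands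


namespace IntegrateOut

/-- Relabelling the coordinates of a representation along an equivalence `Fin n ≃ Fin k` is a
relation of the KZ calculus (a coordinate permutation, rule 2). [folklore] -/
theorem of_sub_of_reindex_mem_relations {n k : ℕ} (r : KZ.IntegralRep n) (e : Fin n ≃ Fin k) :
    KZ.of r - KZ.of (r.reindex e) ∈ KZ.relations := by
  obtain rfl : n = k := by simpa using Fintype.card_congr e
  exact KZ.permRel_subset_relations (KZ.of_sub_of_reindex_mem_permRel r e)

/-- Division of real semialgebraic functions, with Lean's convention `x / 0 = 0`, is
semialgebraic. [folklore] -/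
theorem isSemialgebraicFunOn_div {m : ℕ} {s : Set (Fin m → ℝ)} {f g : (Fin m → ℝ) → ℝ}
    (hf : IsSemialgebraicFunOn ℚ s f) (hg : IsSemialgebraicFunOn ℚ s g) :
    IsSemialgebraicFunOn ℚ s (fun x => f x / g x) := by
  have hs : IsSemialgebraic ℚ s := IsSemialgebraicFunOn.isSemialgebraic_holds hf
  have hZ : IsSemialgebraic ℚ {x | x ∈ s ∧ g x = (fun _ => ((0 : ℚ) : ℝ)) x} :=
    isSemialgebraic_sep_eq hg (isSemialgebraicFunOn_ratCast hs 0)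
  have hZ' : IsSemialgebraic ℚ (s \ {x | x ∈ s ∧ g x = (fun _ => ((0 : ℚ) : ℝ)) x}) := hs.diff hZ
  have h1 : IsSemialgebraicFunOn ℚ (s \ {x | x ∈ s ∧ g x = (fun _ => ((0 : ℚ) : ℝ)) x})
      (fun x => f x / g x) :=
    (hf.mono Set.sdiff_subset hZ').div (hg.mono Set.sdiff_subset hZ') fun x hx h0 =>
      hx.2 ⟨hx.1, by simpa⟩
  have h2 : IsSemialgebraicFunOn ℚ {x | x ∈ s ∧ g x = (fun _ => ((0 : ℚ) : ℝ)) x}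
      (fun _ => ((0 : ℚ) : ℝ)) := isSemialgebraicFunOn_ratCast hZ 0
  have h := IsSemialgebraicFunOn.union h1 h2 (F := fun x => f x / g x) (fun _ _ => rfl)
    fun x hx => by
      have h0 : g x = 0 := by simpa using hx.2
      simp [h0]
  rwa [Set.sdiff_union_of_subset (fun x hx => hx.1)] at h

/-- Finite products of real semialgebraic functions are semialgebraic. [folklore] -/
theorem isSemialgebraicFunOn_finset_prod {N : ℕ} {ι : Type*} (S : Finset ι)
    {σ : Set (Fin N → ℝ)} (hσ : IsSemialgebraic ℚ σ) {f : ι → (Fin N → ℝ) → ℝ}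
    (h : ∀ i ∈ S, IsSemialgebraicFunOn ℚ σ (f i)) :
    IsSemialgebraicFunOn ℚ σ (fun x => ∏ i ∈ S, f i x) := by
  classical
  induction S using Finset.induction_on with
  | empty => simpa using isSemialgebraicFunOn_ratCast hσ 1
  | insert a S ha ih =>
    have h' := IsSemialgebraicFunOn.mul_holds (h a (Finset.mem_insert_self a S))
      (ih fun i hi => h i (Finset.mem_insert_of_mem hi))
    refine h'.congr fun x _ => ?_
    simp [Finset.prod_insert ha]

/-- Natural powers of a real semialgebraic function are semialgebraic. [folklore] -/
theorem isSemialgebraicFunOn_pow {N : ℕ} {σ : Set (Fin N → ℝ)} {f : (Fin N → ℝ) → ℝ}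
    (hf : IsSemialgebraicFunOn ℚ σ f) (n : ℕ) : IsSemialgebraicFunOn ℚ σ (fun x => f x ^ n) := by
  have := isSemialgebraicFunOn_finset_prod (Finset.range n)
    (IsSemialgebraicFunOn.isSemialgebraic_holds hf) (f := fun _ => f) fun _ _ => hf
  simpa using this

/-! ### Fibres along the last coordinate -/

/-- `t ↦ Fin.snoc x t` is continuous. [folklore] -/
theorem continuous_snoc {N : ℕ} (x : Fin N → ℝ) :
    Continuous fun t : ℝ => (Fin.snoc x t : Fin (N + 1) → ℝ) := by
  refine continuous_pi fun j => ?_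
  refine Fin.lastCases ?_ (fun i => ?_) j
  · simpa using continuous_id'
  · simpa using continuous_const

/-- Splitting off the last coordinate, `ℝ^{N+1} ≃ ℝ^N × ℝ`, as a volume-preserving measurable
equivalence with inverse `(x, t) ↦ Fin.snoc x t`. [folklore] -/
theorem exists_measurableEquiv_snoc (N : ℕ) :
    ∃ e : (Fin (N + 1) → ℝ) ≃ᵐ (Fin N → ℝ) × ℝ,
      MeasurePreserving e volume ((volume : Measure (Fin N → ℝ)).prod (volume : Measure ℝ)) ∧
      ∀ q, e.symm q = Fin.snoc q.1 q.2 := by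
  refine ⟨(MeasurableEquiv.piFinSuccAbove (fun _ => ℝ) (Fin.last N)).trans
    MeasurableEquiv.prodComm, ?_, fun q => ?_⟩
  · refine (volume_preserving_piFinSuccAbove (fun _ => ℝ) (Fin.last N)).trans ?_
    rw [Measure.volume_eq_prod]
    exact Measure.measurePreserving_swap
  · show (MeasurableEquiv.piFinSuccAbove (fun _ => ℝ) (Fin.last N)).symm (q.2, q.1) = _
    rw [MeasurableEquiv.piFinSuccAbove_symm_apply, Fin.insertNthEquiv_last]
    rfl

/-- Tonelli along the last coordinate for a non-negative function: the total integral is the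
iterated integral over the last-coordinate fibres, and the fibre integral is a.e.-measurable.
[folklore] -/
theorem lintegral_eq_lintegral_lintegral_snoc {N : ℕ} {Φ : (Fin (N + 1) → ℝ) → ENNReal}
    (hΦ : AEMeasurable Φ volume) :
    (∫⁻ z, Φ z = ∫⁻ x : Fin N → ℝ, ∫⁻ t : ℝ, Φ (Fin.snoc x t)) ∧
      AEMeasurable (fun x : Fin N → ℝ => ∫⁻ t : ℝ, Φ (Fin.snoc x t)) volume := by
  obtain ⟨e, he, he_symm⟩ := exists_measurableEquiv_snoc N
  have hae : AEMeasurable (fun q : (Fin N → ℝ) × ℝ => Φ (e.symm q))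
      ((volume : Measure (Fin N → ℝ)).prod (volume : Measure ℝ)) :=
    ((he.symm e).aemeasurable_comp_iff e.symm.measurableEmbedding).mpr hΦ
  have h1 : ∫⁻ z, Φ z =
      ∫⁻ q, Φ (e.symm q) ∂((volume : Measure (Fin N → ℝ)).prod (volume : Measure ℝ)) :=
    ((he.symm e).lintegral_comp_emb e.symm.measurableEmbedding Φ).symm
  refine ⟨?_, ?_⟩
  · rw [h1, lintegral_prod _ hae]
    simp_rw [he_symm]
  · have := hae.lintegral_prod_right'
    simpa [he_symm] using this

/-- **Null by fibrewise divergence.** If `f` is absolutely integrable on a measurable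
`A ⊆ ℝ^{N+1}` and over every base point the last-coordinate fibre of `A` is empty or carries an
infinite integral of `|f|`, then `A` is Lebesgue-null (Tonelli). [folklore] -/
theorem volume_eq_zero_of_lintegral_fibre_eq_top {N : ℕ} {f : (Fin (N + 1) → ℝ) → ℝ}
    {A : Set (Fin (N + 1) → ℝ)} (hAm : MeasurableSet A) (hf : IntegrableOn f A)
    (hdiv : ∀ x : Fin N → ℝ, {t : ℝ | (Fin.snoc x t : Fin (N + 1) → ℝ) ∈ A} = ∅ ∨
      ∫⁻ t in {t : ℝ | (Fin.snoc x t : Fin (N + 1) → ℝ) ∈ A}, ‖f (Fin.snoc x t)‖ₑ = ⊤) :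
    volume A = 0 := by
  set Φ : (Fin (N + 1) → ℝ) → ENNReal := A.indicator fun z => ‖f z‖ₑ with hΦ_def
  have hΦm : AEMeasurable Φ volume :=
    (aemeasurable_indicator_iff hAm).mpr hf.aestronglyMeasurable.enorm
  have hfin : ∫⁻ z, Φ z ≠ ⊤ := by
    rw [hΦ_def, lintegral_indicator hAm]
    exact hf.2.ne
  obtain ⟨hT, hTm⟩ := lintegral_eq_lintegral_lintegral_snoc hΦm
  rw [hT] at hfin
  have hmeas : ∀ x : Fin N → ℝ, MeasurableSet {t : ℝ | (Fin.snoc x t : Fin (N + 1) → ℝ) ∈ A} :=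
    fun x => (continuous_snoc x).measurable hAm
  have hae : ∀ᵐ x : Fin N → ℝ, {t : ℝ | (Fin.snoc x t : Fin (N + 1) → ℝ) ∈ A} = ∅ := by
    filter_upwards [ae_lt_top' hTm hfin] with x hx
    rcases hdiv x with h | h
    · exact h
    · rw [← lintegral_indicator (hmeas x)] at h
      exact absurd (h ▸ hx) (lt_irrefl _)
  obtain ⟨e, he, he_symm⟩ := exists_measurableEquiv_snoc N
  rw [← (he.symm e).measure_preimage hAm.nullMeasurableSet,
    Measure.prod_apply (e.symm.measurable hAm)]
  refine (lintegral_congr_ae (hae.mono fun x hx => ?_)).trans lintegral_zero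
  have : Prod.mk x ⁻¹' (e.symm ⁻¹' A) = {t : ℝ | (Fin.snoc x t : Fin (N + 1) → ℝ) ∈ A} := by
    ext t; simp [he_symm]
  rw [this, hx, measure_empty]

/-- **Divergence at a pole of order `≥ 1`.** For `K ≠ 0`, `n ≥ 1`, `u < v` and `c ∈ [u, v]`,
`∫_{(u,v)} |K / (t − c)^n| dt = ∞` (comparison with `(t − c)⁻¹`, `intervalIntegrable_sub_inv_iff`).
[folklore] -/
theorem lintegral_enorm_div_pow_eq_top {K c u v : ℝ} (hK : K ≠ 0) (huv : u < v)
    (hc : c ∈ Icc u v) {n : ℕ} (hn : 1 ≤ n) :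
    ∫⁻ t in Ioo u v, ‖K / (t - c) ^ n‖ₑ = ⊤ := by
  by_contra hne
  have hu'v' : max u (c - 1) < min v (c + 1) := by
    simp only [lt_min_iff, max_lt_iff]
    exact ⟨⟨huv, by linarith [hc.2]⟩, by linarith [hc.1], by linarith⟩
  have hsub : Ioo (max u (c - 1)) (min v (c + 1)) ⊆ Ioo u v :=
    Ioo_subset_Ioo (le_max_left _ _) (min_le_left _ _)
  have hmeas : Measurable fun t : ℝ => K / (t - c) ^ n :=
    measurable_const.div ((measurable_id.sub_const c).pow_const n)
  have hint : IntegrableOn (fun t => K / (t - c) ^ n) (Ioo u v) :=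
    ⟨hmeas.aestronglyMeasurable, lt_top_iff_ne_top.mpr hne⟩
  have hint' : IntegrableOn (fun t => (t - c)⁻¹) (Ioo (max u (c - 1)) (min v (c + 1))) := by
    have hg : IntegrableOn (fun t => |K|⁻¹ * ‖K / (t - c) ^ n‖)
        (Ioo (max u (c - 1)) (min v (c + 1))) := (hint.mono_set hsub).norm.const_mul _
    refine hg.mono' (measurable_id.sub_const c).inv.aestronglyMeasurable ?_
    rw [ae_restrict_iff' measurableSet_Ioo]
    refine (ae_iff.mpr ?_).mono fun t (hta : t ≠ c) ht => ?_
    · simp only [not_not, setOf_eq_eq_singleton, Real.volume_singleton]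
    · have hpos : 0 < |t - c| := abs_pos.mpr (sub_ne_zero.mpr hta)
      have h1 : |t - c| ≤ 1 := by
        rw [abs_le]
        simp only [mem_Ioo, max_lt_iff, lt_min_iff] at ht
        constructor <;> linarith [ht.1.2, ht.2.2]
      have h2 : |t - c| ^ n ≤ |t - c| := by
        calc |t - c| ^ n ≤ |t - c| ^ 1 := pow_le_pow_of_le_one hpos.le h1 hn
          _ = |t - c| := pow_one _
      rw [Real.norm_eq_abs, Real.norm_eq_abs, abs_inv, abs_div, abs_pow, ← mul_div_assoc,
        inv_mul_cancel₀ (abs_ne_zero.mpr hK), one_div]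
      exact inv_anti₀ (pow_pos hpos n) h2
  have := (intervalIntegrable_iff_integrableOn_Ioo_of_le hu'v'.le).mpr hint'
  rw [intervalIntegrable_sub_inv_iff] at this
  rcases this with h | h
  · exact hu'v'.ne h
  · refine h (mem_uIcc_of_le ?_ ?_)
    · exact max_le hc.1 (by linarith)
    · exact le_min hc.2 (by linarith)

/-! ### The Newton–Leibniz move over an open band, packaged -/

/-- **Newton–Leibniz over an open band** (rule 3 of the KZ calculus, with rule 1 to close the
band). Let `τ ⊆ ℝ^N` be `ℚ`-semialgebraic, `a < b` `ℚ`-semialgebraic on `τ`, `r` a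
representation on the open band `{(x, t) | x ∈ τ, a x < t < b x}` whose integrand agrees there
with a function `f` which, like the primitive `F`, is `ℚ`-semialgebraic on the closed band;
suppose `t ↦ F (x, t)` is continuous on `[a x, b x]` with derivative `f (x, ·)` on `(a x, b x)`
for `x ∈ τ`. Then `[r] ≡ [τ, F (x, b x) − F (x, a x)]` modulo relations; the base integrand is
absolutely integrable by Fubini and the fundamental theorem of calculus.
[Kontsevich–Zagier 2001, §1.2, rule (3)] [folklore] -/
theorem newtonLeibniz_pack {N : ℕ} {τ : Set (Fin N → ℝ)} (hτ : IsSemialgebraic ℚ τ)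
    {a b : (Fin N → ℝ) → ℝ} (ha : IsSemialgebraicFunOn ℚ τ a) (hb : IsSemialgebraicFunOn ℚ τ b)
    (hab : ∀ x ∈ τ, a x < b x) {f F : (Fin (N + 1) → ℝ) → ℝ}
    (hf : IsSemialgebraicFunOn ℚ (KZlog.band τ a b) f)
    (hF : IsSemialgebraicFunOn ℚ (KZlog.band τ a b) F)
    (hcont : ∀ x ∈ τ, ContinuousOn (fun t => F (Fin.snoc x t)) (Icc (a x) (b x)))
    (hder : ∀ x ∈ τ, ∀ t ∈ Ioo (a x) (b x),
      HasDerivAt (fun s => F (Fin.snoc x s)) (f (Fin.snoc x t)) t)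
    (r : KZ.IntegralRep (N + 1))
    (hrd : r.domain = {z | (Fin.init z : Fin N → ℝ) ∈ τ ∧ a (Fin.init z) < z (Fin.last N) ∧
      z (Fin.last N) < b (Fin.init z)})
    (hri : EqOn r.integrand f r.domain) :
    ∃ r' : KZ.IntegralRep N, r'.domain = τ ∧
      (r'.integrand = fun x => F (Fin.snoc x (b x)) - F (Fin.snoc x (a x))) ∧
      KZ.of r - KZ.of r' ∈ KZ.relations := by
  have hτm : MeasurableSet τ := IsSemialgebraic.measurableSet_holds hτ
  have hBsa : IsSemialgebraic ℚ (KZlog.band τ a b) := KZlog.isSemialgebraic_band ha hb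
  have hBm : MeasurableSet (KZlog.band τ a b) := IsSemialgebraic.measurableSet_holds hBsa
  have hsub : r.domain ⊆ KZlog.band τ a b := by
    rw [hrd]; exact fun z hz => ⟨hz.1, hz.2.1.le, hz.2.2.le⟩
  have hdiff : KZlog.band τ a b \ r.domain ⊆
      {z | (Fin.init z : Fin N → ℝ) ∈ τ ∧ z (Fin.last N) = a (Fin.init z)} ∪
        {z | (Fin.init z : Fin N → ℝ) ∈ τ ∧ z (Fin.last N) = b (Fin.init z)} := by
    rw [hrd]
    rintro z ⟨⟨hzτ, h1, h2⟩, hz⟩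
    simp only [mem_setOf_eq, not_and, not_lt] at hz
    rcases h1.lt_or_eq with h1 | h1
    · exact Or.inr ⟨hzτ, le_antisymm h2 (hz hzτ h1)⟩
    · exact Or.inl ⟨hzτ, h1.symm⟩
  have hnull : volume (KZlog.band τ a b \ r.domain) = 0 :=
    measure_mono_null hdiff (measure_union_null (KZ.volume_graph_eq_zero ha)
      (KZ.volume_graph_eq_zero hb))
  have hfO : IntegrableOn f r.domain :=
    r.integrableOn.congr_fun hri (KZ.IntegralRep.measurableSet_domain_holds r)
  have hfB : IntegrableOn f (KZlog.band τ a b) := by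
    rw [← Set.union_sdiff_cancel hsub]
    exact integrableOn_union.mpr ⟨hfO, IntegrableOn.of_measure_zero hnull⟩
  let r₂ : KZ.IntegralRep (N + 1) := ⟨KZlog.band τ a b, f, hBsa, hf, hfB⟩
  have h12 : KZ.of r - KZ.of r₂ ∈ KZ.relations := by
    refine KZ.of_sub_of_mem_relations_of_null r r₂ ?_ hnull fun z hz => hri hz.1
    rw [Set.sdiff_eq_empty.mpr hsub, measure_empty]
  -- the base integrand and its semialgebraicity
  have hmap : ∀ {c : (Fin N → ℝ) → ℝ}, IsSemialgebraicFunOn ℚ τ c →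
      (∀ x ∈ τ, c x ∈ Icc (a x) (b x)) →
      IsSemialgebraicFunOn ℚ τ (fun x => F (Fin.snoc x (c x))) := by
    intro c hc hcm
    have hφ : IsSemialgebraicMapOn ℚ τ (fun x => (Fin.snoc x (c x) : Fin (N + 1) → ℝ)) := by
      refine IsSemialgebraicMapOn.of_forall hτ fun j => ?_
      refine Fin.lastCases ?_ (fun i => ?_) j
      · simpa using hc
      · simpa using isSemialgebraicFunOn_apply hτ i
    exact IsSemialgebraicFunOn.comp_isSemialgebraicMapOn_holds hF hφ
      fun x hx => KZlog.snoc_mem_band.mpr ⟨hx, hcm x hx⟩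
  have hgsa : IsSemialgebraicFunOn ℚ τ (fun x => F (Fin.snoc x (b x)) - F (Fin.snoc x (a x))) :=
    IsSemialgebraicFunOn.sub_holds (hmap hb fun x hx => Set.right_mem_Icc.mpr (hab x hx).le)
      (hmap ha fun x hx => Set.left_mem_Icc.mpr (hab x hx).le)
  -- integrability of the base integrand: Fubini and the fundamental theorem of calculus
  set G : (Fin (N + 1) → ℝ) → ℝ := (KZlog.band τ a b).indicator f with hG_def
  have hG : Integrable G := (integrable_indicator_iff hBm).mpr hfB
  obtain ⟨e, he, he_symm⟩ := exists_measurableEquiv_snoc N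
  have hG2 : Integrable (fun q : (Fin N → ℝ) × ℝ => G (Fin.snoc q.1 q.2))
      ((volume : Measure (Fin N → ℝ)).prod (volume : Measure ℝ)) := by
    have h := ((he.symm e).integrable_comp_emb e.symm.measurableEmbedding (g := G)).mpr hG
    convert h using 1
    ext q
    simp [he_symm]
  have hfib_in : ∀ x ∈ τ, (fun t => G (Fin.snoc x t)) =
      (Icc (a x) (b x)).indicator (fun t => f (Fin.snoc x t)) := by
    intro x hx
    ext t
    by_cases ht : t ∈ Icc (a x) (b x)
    · rw [indicator_of_mem ht, hG_def, indicator_of_mem (KZlog.snoc_mem_band.mpr ⟨hx, ht⟩)]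
    · rw [indicator_of_notMem ht, hG_def,
        indicator_of_notMem (fun h => ht (KZlog.snoc_mem_band.mp h).2)]
  have hgx : ∀ x ∈ τ, Integrable (fun t => G (Fin.snoc x t)) →
      F (Fin.snoc x (b x)) - F (Fin.snoc x (a x)) = ∫ t, G (Fin.snoc x t) := by
    intro x hx hxi
    rw [hfib_in x hx, integral_indicator measurableSet_Icc, integral_Icc_eq_integral_Ioc,
      ← intervalIntegral.integral_of_le (hab x hx).le]
    refine (intervalIntegral.integral_eq_sub_of_hasDerivAt_of_le (hab x hx).le (hcont x hx)
      (hder x hx) ?_).symm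
    rw [intervalIntegrable_iff_integrableOn_Icc_of_le (hab x hx).le]
    have h' := hxi
    rw [hfib_in x hx] at h'
    exact (integrable_indicator_iff measurableSet_Icc).mp h'
  have hgi : IntegrableOn (fun x => F (Fin.snoc x (b x)) - F (Fin.snoc x (a x))) τ := by
    refine Integrable.mono' hG2.integral_norm_prod_left.integrableOn.integrable
      (KZ.aestronglyMeasurable_of_isSemialgebraicFunOn hgsa hτm) ?_
    rw [ae_restrict_iff' hτm]
    filter_upwards [hG2.prod_right_ae] with x hx hxτ
    rw [hgx x hxτ hx]
    exact norm_integral_le_integral_norm _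
  let r' : KZ.IntegralRep N :=
    ⟨τ, fun x => F (Fin.snoc x (b x)) - F (Fin.snoc x (a x)), hτ, hgsa, hgi⟩
  have h23 : KZ.of r₂ - KZ.of r' ∈ KZ.relations :=
    KZ.newtonLeibnizRel_subset_relations ⟨N, r₂, r', a, b, F, hF, ha, hb,
      fun x hx => (hab x hx).le, rfl, hcont, hder, fun x _ => rfl, rfl⟩
  refine ⟨r', rfl, rfl, ?_⟩
  have : KZ.of r - KZ.of r' = (KZ.of r - KZ.of r₂) + (KZ.of r₂ - KZ.of r') := by abel
  rw [this]
  exact KZ.relations.add_mem h12 h23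


/-! ### Rational affine data -/

/-- Evaluation of an affine datum `c = (c₁, c₀)` (rational coefficients) at `x ∈ ℝᴮ`:
`∑ᵢ c₁ i · x i + c₀`. [folklore] -/
def ev {B : ℕ} (c : (Fin B → ℚ) × ℚ) (x : Fin B → ℝ) : ℝ := ∑ i, (c.1 i : ℝ) * x i + (c.2 : ℝ)

/-- `ev` is additive in the datum. [folklore] -/
theorem ev_sub {B : ℕ} (c c' : (Fin B → ℚ) × ℚ) (x : Fin B → ℝ) :
    ev (c - c') x = ev c x - ev c' x := by
  simp only [ev, Prod.fst_sub, Prod.snd_sub, Pi.sub_apply, Rat.cast_sub, sub_mul,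
    Finset.sum_sub_distrib]
  ring

/-- `ev` is homogeneous in the datum. [folklore] -/
theorem ev_smul {B : ℕ} (q : ℚ) (c : (Fin B → ℚ) × ℚ) (x : Fin B → ℝ) :
    ev (q • c) x = q * ev c x := by
  simp only [ev, Prod.smul_fst, Prod.smul_snd, Pi.smul_apply, smul_eq_mul, Rat.cast_mul,
    mul_assoc, Finset.mul_sum, mul_add]

/-- The affine datum `c` as a degree-one polynomial in the variables `ι i`. [folklore] -/
def affPoly {B N : ℕ} (ι : Fin B → Fin N) (c : (Fin B → ℚ) × ℚ) : MvPolynomial (Fin N) ℚ :=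
  ∑ i, MvPolynomial.C (c.1 i) * MvPolynomial.X (ι i) + MvPolynomial.C c.2

/-- Evaluating `affPoly ι c` is evaluating `c` on the `ι`-coordinates. [folklore] -/
theorem aeval_affPoly {B N : ℕ} (ι : Fin B → Fin N) (c : (Fin B → ℚ) × ℚ) (x : Fin N → ℝ) :
    MvPolynomial.aeval x (affPoly ι c) = ev c (fun i => x (ι i)) := by
  simp [affPoly, ev]

/-- `ev c` is `ℚ`-semialgebraic on every `ℚ`-semialgebraic set. [folklore] -/
theorem isSemialgebraicFunOn_ev {B : ℕ} {σ : Set (Fin B → ℝ)} (hσ : IsSemialgebraic ℚ σ)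
    (c : (Fin B → ℚ) × ℚ) : IsSemialgebraicFunOn ℚ σ (ev c) :=
  (isSemialgebraicFunOn_aeval hσ (affPoly id c)).congr fun x _ => aeval_affPoly _ c x

end IntegrateOut

open IntegrateOut in
/-- **Newton–Leibniz over an open band between affine functions** (registered sub-goal of
`stub_integrateOut`, part 1): the packaged rule-3 move `IntegrateOut.newtonLeibniz_pack`
specialised to rational affine bounds `P < S` over a `ℚ`-semialgebraic base. -/
theorem integrateOut_newtonLeibniz (N : ℕ) (τ : Set (Fin N → ℝ)) (hτ : Literature.ModelTheory.ExponentialFields.IsSemialgebraic ℚ τ) (P S : (Fin N → ℚ) × ℚ) (hPS : ∀ x ∈ τ, IntegrateOut.ev P x < IntegrateOut.ev S x) (f F : (Fin (N + 1) → ℝ) → ℝ) (hf : IsSemialgebraicFunOn ℚ (KZlog.band τ (IntegrateOut.ev P) (IntegrateOut.ev S)) f) (hF : IsSemialgebraicFunOn ℚ (KZlog.band τ (IntegrateOut.ev P) (IntegrateOut.ev S)) F) (hcont : ∀ x ∈ τ, ContinuousOn (fun t => F (Fin.snoc x t)) (Set.Icc (IntegrateOut.ev P x) (IntegrateOut.ev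 S x))) (hder : ∀ x ∈ τ, ∀ t ∈ Set.Ioo (IntegrateOut.ev P x) (IntegrateOut.ev S x), HasDerivAt (fun s => F (Fin.snoc x s)) (f (Fin.snoc x t)) t) (r : KZ.IntegralRep (N + 1)) (hrd : r.domain = {z | (Fin.init z : Fin N → ℝ) ∈ τ ∧ IntegrateOut.ev P (Fin.init z) < z (Fin.last N) ∧ z (Fin.last N) < IntegrateOut.ev S (Fin.init z)}) (hri : Set.EqOn r.integrand f r.domain) : ∃ r' : KZ.IntegralRep N, r'.domain = τ ∧ (r'.integrand = fun x => F (Fin.snoc x (IntegrateOut.ev S x)) - F (Fin.snoc x (IntegrateOut.ev P x))) ∧ KZ.of r - KZ.of r' ∈ KZ.relations :=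
  newtonLeibniz_pack hτ (isSemialgebraicFunOn_ev hτ P) (isSemialgebraicFunOn_ev hτ S) hPS hf hF
    hcont hder r hrd hri

end Summit.KontsevichZagierPeriods.ArrangementNormalForm.JanusBands
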